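import Summits.BirchSwinnertonDyer.BirchSwinnertonDyer.Theorems.PrintCFramBottomClassIndexLawFiveLeLevelCriterion
import Summits.BirchSwinnertonDyer.Uniform.UI.O2DenominatorSquare
import Summits.BirchSwinnertonDyer.BirchSwinnertonDyer.Theorems.PrintCFramBottomClassIndexLawFiveLeLevelDictionaryAlpha
import HarnessLib

/-!
# Route `PrintCFram`, crux C2 `BottomClassIndexLawFiveLe` (stmt-BirchSwinnertonDyer-20372), line
# `eisenstein-resource-bdp-line` (registry v21: `stub_bsdp_of_level` = B1-level): **THE LEVEL BINDER IN ELEMENTARY CURRENCY, II —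
# THE EXACT LEVEL IS `v_p(den x(12 • P))/2`; B1-level ⟺ «`p ∣ den x(12 • g)` ⟹ `BSD_p`»; ON THE KRIZ–LI LOCUS `x(12 • g)` IS `p`-INTEGRAL**
# (cell `bsd-print-cfram`, width seat `bsd-line-cfram-p1-w6` g5; helper `--supports` 20372; 0 defs, 0 facts, 0 sorry)

HONEST FRAMING. Nothing about BSD is proved here and no stub is closed. Sequel of `…LevelCriterion` (`ι P ∈ p^k W(ℚ_p) ⟺ p^{2k} ∣ den x(12 • P)`
for `W/ℚ` globally minimal, ADDITIVE at `p ≥ 5`, `W(ℚ_p)[p] = 0`, `k ≥ 1`). Here the crux's binders are read off ONE rational number: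

* §1 `exists_pow_nsmul_eq_toPadicPoint_iff_le_padicValNat_den` (`ι P ∈ p^k W(ℚ_p) ⟺ 2k ≤ v_p(den x)`, every `k`);
  **`level_iff_padicValNat_den_eq`** — the binder pair «`∃ Q, p^n • Q = ι P` ∧ `∀ Q, p^{n+1} • Q ≠ ι P`» of
  `X12.O11.RamifiedCMBottomClassIndexLawAtZp` (the `n`, `n'` of the value law `c = n + n' + ord_p q + ord_p q'`) holds **iff `v_p(den x(12 • P)) = 2n`**
  (`v_p(den x)` is even on a globally minimal model, `Uniform.UI.O2.even_padicValNat_den`); `exists_level_eq_padicValNat_den_div_two` (every rational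
  point with `12 • P ≠ O` HAS the finite exact level `v_p(den x(12 • P))/2` — the binder pair is always instantiable);
  `exists_prime_nsmul_eq_toPadicPoint_iff_dvd_den` (level `≥ 1 ⟺ p ∣ den x(12 • P)`).
* §2 the CM-RAMIFIED class member (`Addv` by `X12.addv_of_hasCM_of_cmRamified'`, `W(ℚ_p)[p] = 0` by k7r's
  `prime_nsmul_eq_zero_padic_of_hasCM_of_cmRamified`): **`level_iff_padicValNat_den_eq_of_cmRamified`**, `exists_level_of_cmRamified`,
  **`exists_prime_nsmul_eq_toPadicPoint_iff_dvd_den_of_cmRamified`**; `exists_twelve_nsmul_eq_some`.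
* §3 **`stubLevel_iff_stubDen`** — registry v20/v21's `stub_bsdp_of_level` (B1-level, VERBATIM) ⟺ its twin «rank-one CM-ramified member, generator
  `P` of `W(ℚ)/tors`, `12 • P = (x, y)`, `p ∣ den x` ⟹ `BSD_p W p`» — a promotion text with no `ℚ_p`, no character, no Bernoulli number.
* §4 with w6 g3's (α) (`LevelDictionaryAlpha.norm_bernoulliOnePrim_le_of_level_pos_of_generator`): **`norm_bernoulliOnePrim_le_of_dvd_den`**
  (`p ∣ den x(12 • g)` ⟹ `‖B_{1,ψ⁻¹}‖_p ≤ p⁻¹` for an odd Kriz–Li datum with `hss`) and **`not_dvd_den_of_unit_classFactor`** (UNIT class factor —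
  the Kriz–Li locus — ⟹ `p ∤ den x(12 • g)`: on the regular branch the generator's `12`-multiple is `p`-integral).

DATA CHECK (ty3 `X12/CMRamifiedLevelsFiveLe`, two engines): `17424bl1` at `p = 11` (`y² = x³ − 1056x + 13552`, `G = (33, 121)`):
`v_11(den x(12 • G)) = 2` — level `n = 1` as recorded; the record's column `v_p(x([2p·#tors]G)) = −2(n+1)` is §1 after one `[p]`-shift.
THEOREMS ONLY; no definition, no named fact, no `sorry`. BSD is not proved by any of this; no summit statement is proved by this seat.
References: [SilvermanAEC2009] IV.6.4, VII.2.1–2.2, VII.6.1, VII.6.3; [SilvermanATAEC1994] Cor. IV.9.2(d); [KrizLi2019] §1.5, (29);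
[BurungaleKobayashiNakamuraOta2026] §1.4 (why B1-level is open).
-/

set_option autoImplicit false
-- `…BirchSwinnertonDyer.BirchSwinnertonDyer.Theorems…` is the problem's mandated namespace (D-0017).
set_option linter.dupNamespace false

noncomputable section

open scoped Classical

namespace Summit.BirchSwinnertonDyer.BirchSwinnertonDyer.Theorems.PrintCFram.LevelCriterion

open WeierstrassCurve Literature.NumberTheory.EllipticCurves Literature.NumberTheory.EllipticCurves.Rank1Residual
open Summit.BirchSwinnertonDyer.Uniform.UI.O2 DirichletCharacter Literature.NumberTheory.EllipticCurves.KrizLi2019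
open Summit.BirchSwinnertonDyer.BirchSwinnertonDyer.Theorems.PrintCFram.LevelDictionaryAlpha

variable (W : WeierstrassCurve ℚ) [W.IsElliptic] [W.IsGloballyMinimal] (p : ℕ) [hp : Fact p.Prime]

/-! ## §1 The exact level: `n = v_p(den x(12 • P)) / 2` -/

/-- **`ι P ∈ p^k W(ℚ_p)` iff `2k ≤ v_p(den x(12 • P))`** — every `k` (`k = 0` trivially), `W` globally minimal, ADDITIVE at `p ≥ 5`,
`W(ℚ_p)[p] = 0`, `12 • P = (x, y)`. [cite: SilvermanAEC2009, VII.2 Prop. 2.1–2.2, IV.6.4, VII.6.1, VII.6.3] -/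
theorem exists_pow_nsmul_eq_toPadicPoint_iff_le_padicValNat_den (hp5 : 5 ≤ p) (hadd : Addv W p)
    (htors : ∀ Q : (W.baseChange ℚ_[p]).toAffine.Point, p • Q = 0 → Q = 0)
    {P : W.toAffine.Point} {x y : ℚ} {hxy : W.toAffine.Nonsingular x y} (h12 : 12 • P = .some x y hxy) (k : ℕ) :
    (∃ Q : (W.baseChange ℚ_[p]).toAffine.Point, p ^ k • Q = W.toPadicPoint p P) ↔ 2 * k ≤ padicValNat p x.den := by
  rcases Nat.eq_zero_or_pos k with rfl | hk
  · simp only [pow_zero, one_nsmul, exists_eq, mul_zero, zero_le]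
  · rw [exists_pow_nsmul_eq_toPadicPoint_iff_pow_dvd_den W p hp5 hadd htors h12 hk, padicValNat_dvd_iff_le x.den_nz]

/-- **THE EXACT LEVEL IS HALF THE `p`-ADIC VALUATION OF THE DENOMINATOR OF `x(12 • P)`.** `W/ℚ` globally minimal, ADDITIVE at
`p ≥ 5`, `W(ℚ_p)[p] = 0`, `P ∈ W(ℚ)` with `12 • P = (x, y)`: the crux's binder pair «`∃ Q, p^n • Q = ι P` and `∀ Q, p^{n+1} • Q ≠ ι P`»
(`X12.O11.RamifiedCMBottomClassIndexLawAtZp`) holds **iff `v_p(den x) = 2n`** (`v_p(den x)` is even for a rational point of a globally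
minimal model, `Uniform.UI.O2.even_padicValNat_den`). [cite: SilvermanAEC2009, VII.2 Prop. 2.1–2.2, IV.6.4, VII.6.1, VII.6.3] -/
theorem level_iff_padicValNat_den_eq (hp5 : 5 ≤ p) (hadd : Addv W p)
    (htors : ∀ Q : (W.baseChange ℚ_[p]).toAffine.Point, p • Q = 0 → Q = 0)
    {P : W.toAffine.Point} {x y : ℚ} {hxy : W.toAffine.Nonsingular x y} (h12 : 12 • P = .some x y hxy) (n : ℕ) :
    ((∃ Q : (W.baseChange ℚ_[p]).toAffine.Point, p ^ n • Q = W.toPadicPoint p P) ∧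
      (∀ Q : (W.baseChange ℚ_[p]).toAffine.Point, p ^ (n + 1) • Q ≠ W.toPadicPoint p P)) ↔
      padicValNat p x.den = 2 * n := by
  obtain ⟨u, hu⟩ := even_padicValNat_den hxy p
  have hne : (∀ Q : (W.baseChange ℚ_[p]).toAffine.Point, p ^ (n + 1) • Q ≠ W.toPadicPoint p P) ↔
      ¬ 2 * (n + 1) ≤ padicValNat p x.den := by
    rw [← exists_pow_nsmul_eq_toPadicPoint_iff_le_padicValNat_den W p hp5 hadd htors h12 (n + 1), not_exists]
  rw [exists_pow_nsmul_eq_toPadicPoint_iff_le_padicValNat_den W p hp5 hadd htors h12 n, hne]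
  omega

/-- **Every rational point with `12 • P ≠ O` HAS a finite exact level, namely `v_p(den x(12 • P))/2`** (the crux's binder pair is
instantiable). [cite: SilvermanAEC2009, VII.2 Prop. 2.1–2.2, VII.6.3] -/
theorem exists_level_eq_padicValNat_den_div_two (hp5 : 5 ≤ p) (hadd : Addv W p)
    (htors : ∀ Q : (W.baseChange ℚ_[p]).toAffine.Point, p • Q = 0 → Q = 0)
    {P : W.toAffine.Point} {x y : ℚ} {hxy : W.toAffine.Nonsingular x y} (h12 : 12 • P = .some x y hxy) :
    ∃ n : ℕ, n = padicValNat p x.den / 2 ∧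
      (∃ Q : (W.baseChange ℚ_[p]).toAffine.Point, p ^ n • Q = W.toPadicPoint p P) ∧
      (∀ Q : (W.baseChange ℚ_[p]).toAffine.Point, p ^ (n + 1) • Q ≠ W.toPadicPoint p P) := by
  obtain ⟨u, hu⟩ := even_padicValNat_den hxy p
  refine ⟨padicValNat p x.den / 2, rfl, (level_iff_padicValNat_den_eq W p hp5 hadd htors h12 _).mpr ?_⟩
  omega

/-- **Level `≥ 1` iff `p ∣ den x(12 • P)`** (the B1-level premise; `p ∣ den ⟺ p² ∣ den` by evenness).
[cite: SilvermanAEC2009, VII.2 Prop. 2.1–2.2, VII.6.3] -/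
theorem exists_prime_nsmul_eq_toPadicPoint_iff_dvd_den (hp5 : 5 ≤ p) (hadd : Addv W p)
    (htors : ∀ Q : (W.baseChange ℚ_[p]).toAffine.Point, p • Q = 0 → Q = 0)
    {P : W.toAffine.Point} {x y : ℚ} {hxy : W.toAffine.Nonsingular x y} (h12 : 12 • P = .some x y hxy) :
    (∃ Q : (W.baseChange ℚ_[p]).toAffine.Point, p • Q = W.toPadicPoint p P) ↔ p ∣ x.den := by
  obtain ⟨u, hu⟩ := even_padicValNat_den hxy p
  have h := exists_pow_nsmul_eq_toPadicPoint_iff_le_padicValNat_den W p hp5 hadd htors h12 1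
  rw [pow_one] at h
  rw [h, dvd_iff_padicValNat_ne_zero x.den_nz]
  omega


/-! ## §2 The CM-RAMIFIED class member (`W` CM, globally minimal, `CMRamified W p`, `p ≥ 5`) -/

/-- **THE CRUX'S LEVEL `n` OF A RATIONAL POINT ON A CM-RAMIFIED CLASS MEMBER IS `v_p(den x(12 • P))/2`:** the binder pair
«`∃ Q : W(ℚ_[p]), p^n • Q = ι P` ∧ `∀ Q, p^{n+1} • Q ≠ ι P`» of `X12.O11.RamifiedCMBottomClassIndexLawAtZp` (the `n`, `n'` of the value law
`c = n + n' + ord_p #Ш_an(W) + ord_p #Ш_an(W')`) holds iff `v_p(den x) = 2n`, where `12 • P = (x, y)`. (`Addv` by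
`X12.addv_of_hasCM_of_cmRamified'`; `W(ℚ_p)[p] = 0` by k7r's `prime_nsmul_eq_zero_padic_of_hasCM_of_cmRamified`.)
[cite: SilvermanAEC2009, VII.2 Prop. 2.1–2.2, IV.6.4, VII.6.1, VII.6.3] [cite: SilvermanATAEC1994, Cor. IV.9.2(d) and App. A §3] -/
theorem level_iff_padicValNat_den_eq_of_cmRamified (hCM : W.HasCM) (hram : CMRamified W p) (h5 : 5 ≤ p)
    {P : W.toAffine.Point} {x y : ℚ} {hxy : W.toAffine.Nonsingular x y} (h12 : 12 • P = .some x y hxy) (n : ℕ) :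
    ((∃ Q : (W.baseChange ℚ_[p]).toAffine.Point, p ^ n • Q = W.toPadicPoint p P) ∧
      (∀ Q : (W.baseChange ℚ_[p]).toAffine.Point, p ^ (n + 1) • Q ≠ W.toPadicPoint p P)) ↔
      padicValNat p x.den = 2 * n :=
  level_iff_padicValNat_den_eq W p h5 (Summit.BirchSwinnertonDyer.Rank1Residual.X12.addv_of_hasCM_of_cmRamified' W p hCM hram)
    (RamifiedSevenEllipticUnits.prime_nsmul_eq_zero_padic_of_hasCM_of_cmRamified W p hCM h5 hram) h12 n

/-- **On a CM-ramified class member every rational point with `12 • P ≠ O` has the finite exact level `v_p(den x(12 • P))/2`.**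
[cite: SilvermanAEC2009, VII.2 Prop. 2.1–2.2, VII.6.3] -/
theorem exists_level_of_cmRamified (hCM : W.HasCM) (hram : CMRamified W p) (h5 : 5 ≤ p)
    {P : W.toAffine.Point} {x y : ℚ} {hxy : W.toAffine.Nonsingular x y} (h12 : 12 • P = .some x y hxy) :
    ∃ n : ℕ, n = padicValNat p x.den / 2 ∧
      (∃ Q : (W.baseChange ℚ_[p]).toAffine.Point, p ^ n • Q = W.toPadicPoint p P) ∧
      (∀ Q : (W.baseChange ℚ_[p]).toAffine.Point, p ^ (n + 1) • Q ≠ W.toPadicPoint p P) :=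
  exists_level_eq_padicValNat_den_div_two W p h5 (Summit.BirchSwinnertonDyer.Rank1Residual.X12.addv_of_hasCM_of_cmRamified' W p hCM hram)
    (RamifiedSevenEllipticUnits.prime_nsmul_eq_zero_padic_of_hasCM_of_cmRamified W p hCM h5 hram) h12

/-- **B1-level's premise on a CM-ramified class member: `∃ Q, p • Q = ι P` iff `p ∣ den x(12 • P)`.**
[cite: SilvermanAEC2009, VII.2 Prop. 2.1–2.2, VII.6.3] -/
theorem exists_prime_nsmul_eq_toPadicPoint_iff_dvd_den_of_cmRamified (hCM : W.HasCM) (hram : CMRamified W p) (h5 : 5 ≤ p)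
    {P : W.toAffine.Point} {x y : ℚ} {hxy : W.toAffine.Nonsingular x y} (h12 : 12 • P = .some x y hxy) :
    (∃ Q : (W.baseChange ℚ_[p]).toAffine.Point, p • Q = W.toPadicPoint p P) ↔ p ∣ x.den :=
  exists_prime_nsmul_eq_toPadicPoint_iff_dvd_den W p h5 (Summit.BirchSwinnertonDyer.Rank1Residual.X12.addv_of_hasCM_of_cmRamified' W p hCM hram)
    (RamifiedSevenEllipticUnits.prime_nsmul_eq_zero_padic_of_hasCM_of_cmRamified W p hCM h5 hram) h12

omit [W.IsElliptic] [W.IsGloballyMinimal] hp in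
/-- A point of infinite order has `12 • P = (x, y)` affine. [folklore] -/
theorem exists_twelve_nsmul_eq_some {P : W.toAffine.Point} (hP : ¬ IsOfFinAddOrder P) :
    ∃ (x y : ℚ) (hxy : W.toAffine.Nonsingular x y), 12 • P = .some x y hxy := by
  rcases h : (12 • P) with _ | ⟨x, y, hxy⟩
  · exact absurd (isOfFinAddOrder_iff_nsmul_eq_zero.mpr ⟨12, by norm_num, h⟩) hP
  · exact ⟨x, y, hxy, rfl⟩

/-! ## §3 `stub_bsdp_of_level` (B1-level, registry v20/v21 VERBATIM) ⟺ ITS DENOMINATOR-CURRENCY TWIN -/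

/-- **B1-level ⟺ B1-den.** The registered research stub `stub_bsdp_of_level` of registry v20/v21 (left side, VERBATIM: `BSD_p` for every
rank-one CM-ramified class member whose generator `P` modulo torsion is `p`-divisible in `W(ℚ_p)`) is EQUIVALENT to its ELEMENTARY twin
(right side): `BSD_p` for every such member whose generator `P` has **`p ∣ den x(12 • P)`** — no `ℚ_p`, no character, no Bernoulli number;
only the Weierstrass coordinates of one rational point. (For a promotion text: «for `W/ℚ` globally minimal with CM, `p ≥ 5` ramified in the CM
field, `r_an(W) = 1`, generator `P` of `W(ℚ)/tors`: if `p` divides the denominator of `x(12P)` then `BSD_p(W)`».)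
[cite: SilvermanAEC2009, VII.2 Prop. 2.1–2.2, IV.6.4, VII.6.1, VII.6.3] [cite: BurungaleKobayashiNakamuraOta2026, §1.4 (arXiv:2608.06879 p. 8)] -/
theorem stubLevel_iff_stubDen :
    (∀ (W : WeierstrassCurve ℚ) [W.IsElliptic] [W.IsGloballyMinimal] (p : ℕ) [Fact p.Prime],
      W.HasCM → CMRamified W p → 5 ≤ p → W.analyticRank = 1 →
      ∀ P : W.toAffine.Point, ¬ IsOfFinAddOrder P →
        (∀ R : W.toAffine.Point, ∃ (k : ℤ) (T : W.toAffine.Point), IsOfFinAddOrder T ∧ R = k • P + T) →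
        (∃ Q : (W.baseChange ℚ_[p]).toAffine.Point, p • Q = W.toPadicPoint p P) →
        BSDp W p) ↔
    (∀ (W : WeierstrassCurve ℚ) [W.IsElliptic] [W.IsGloballyMinimal] (p : ℕ) [Fact p.Prime],
      W.HasCM → CMRamified W p → 5 ≤ p → W.analyticRank = 1 →
      ∀ P : W.toAffine.Point, ¬ IsOfFinAddOrder P →
        (∀ R : W.toAffine.Point, ∃ (k : ℤ) (T : W.toAffine.Point), IsOfFinAddOrder T ∧ R = k • P + T) →
        ∀ (x y : ℚ) (hxy : W.toAffine.Nonsingular x y), 12 • P = .some x y hxy → p ∣ x.den →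
        BSDp W p) := by
  constructor
  · intro hL W _ _ p _ hCM hram h5 hr P hP hgen x y hxy h12 hdvd
    exact hL W p hCM hram h5 hr P hP hgen
      ((exists_prime_nsmul_eq_toPadicPoint_iff_dvd_den_of_cmRamified W p hCM hram h5 h12).mpr hdvd)
  · intro hD W _ _ p _ hCM hram h5 hr P hP hgen hlev
    obtain ⟨x, y, hxy, h12⟩ := exists_twelve_nsmul_eq_some W (P := P) hP
    exact hD W p hCM hram h5 hr P hP hgen x y hxy h12
      ((exists_prime_nsmul_eq_toPadicPoint_iff_dvd_den_of_cmRamified W p hCM hram h5 h12).mp hlev)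


/-! ## §4 With w6 g3's (α): `p ∣ den x(12 • g)` forces a NON-unit class factor; on the Kriz–Li locus `x(12 • g)` is `p`-integral -/

/-- **`p ∣ den x(12 • P)` ⟹ `‖B_{1,ψ⁻¹}‖_p ≤ p⁻¹`** for the generator `P` of `W(ℚ)` modulo torsion of a CM-ramified class member carrying an
odd Kriz–Li datum `(f, ψ, ω)` with the trace congruences `hss` — w6 g3's (α) `LevelDictionaryAlpha.norm_bernoulliOnePrim_le_of_level_pos_of_generator`
read through `exists_prime_nsmul_eq_toPadicPoint_iff_dvd_den_of_cmRamified`: a `p` in the denominator of `x(12 • P)` is visible in the class factor.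
[cite: KrizLi2019, §1.5 (p. 7) and (29) (pp. 49–50)] [cite: SilvermanAEC2009, VII.2.2, VIII.§2, X.§4] -/
theorem norm_bernoulliOnePrim_le_of_dvd_den (hCM : W.HasCM) (hram : CMRamified W p) (h5 : 5 ≤ p)
    {f : ℕ} [NeZero f] (ψ : DirichletCharacter ℚ_[p] f) (ω : DirichletCharacter ℚ_[p] p)
    (hψ : ψ.Odd) (hω : IsTeichmullerCharacter ω)
    (hss : ∀ ℓ : ℕ, ℓ.Prime → ¬ (ℓ ∣ p * W.conductorNorm ℤ) →
      ‖((W.LFunction ℓ : ℤ) : ℚ_[p]) - (ψ (ℓ : ZMod f) + ψ⁻¹ (ℓ : ZMod f) * ω (ℓ : ZMod p))‖ < 1)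
    (P : W.toAffine.Point) (hPtor : ¬ IsOfFinAddOrder P)
    (hgen : ∀ R : W.toAffine.Point, ∃ (k : ℤ) (T : W.toAffine.Point), IsOfFinAddOrder T ∧ R = k • P + T)
    {x y : ℚ} {hxy : W.toAffine.Nonsingular x y} (h12 : 12 • P = .some x y hxy) (hdvd : p ∣ x.den) :
    ‖bernoulliOnePrim ψ⁻¹‖ ≤ (p : ℝ)⁻¹ :=
  norm_bernoulliOnePrim_le_of_level_pos_of_generator p W hCM hram h5 ψ ω hψ hω hss P hPtor hgen
    ((exists_prime_nsmul_eq_toPadicPoint_iff_dvd_den_of_cmRamified W p hCM hram h5 h12).mpr hdvd)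

/-- **On the Kriz–Li locus `x(12 • g)` is `p`-integral.** For a CM-ramified class member with an odd Kriz–Li datum `(f, ψ, ω)`, `hss`, and a
UNIT class factor `¬ ‖B_{1,ψ⁻¹}‖_p ≤ p⁻¹` (the regular = Kriz–Li branch of the line), the generator `P` of `W(ℚ)` modulo torsion has
`p ∤ den x(12 • P)` (level `0` in elementary currency; twin of w6 g3's `level_eq_zero_of_unit_classFactor`).
[cite: KrizLi2019, §1.5 (p. 7) and Thm. 1.20] [cite: SilvermanAEC2009, VII.2.2] -/
theorem not_dvd_den_of_unit_classFactor (hCM : W.HasCM) (hram : CMRamified W p) (h5 : 5 ≤ p)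
    {f : ℕ} [NeZero f] (ψ : DirichletCharacter ℚ_[p] f) (ω : DirichletCharacter ℚ_[p] p)
    (hψ : ψ.Odd) (hω : IsTeichmullerCharacter ω)
    (hss : ∀ ℓ : ℕ, ℓ.Prime → ¬ (ℓ ∣ p * W.conductorNorm ℤ) →
      ‖((W.LFunction ℓ : ℤ) : ℚ_[p]) - (ψ (ℓ : ZMod f) + ψ⁻¹ (ℓ : ZMod f) * ω (ℓ : ZMod p))‖ < 1)
    (hunit : ¬ ‖bernoulliOnePrim ψ⁻¹‖ ≤ (p : ℝ)⁻¹)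
    (P : W.toAffine.Point) (hPtor : ¬ IsOfFinAddOrder P)
    (hgen : ∀ R : W.toAffine.Point, ∃ (k : ℤ) (T : W.toAffine.Point), IsOfFinAddOrder T ∧ R = k • P + T)
    {x y : ℚ} {hxy : W.toAffine.Nonsingular x y} (h12 : 12 • P = .some x y hxy) : ¬ p ∣ x.den :=
  fun hdvd ↦ hunit (norm_bernoulliOnePrim_le_of_dvd_den W p hCM hram h5 ψ ω hψ hω hss P hPtor hgen h12 hdvd)

end Summit.BirchSwinnertonDyer.BirchSwinnertonDyer.Theorems.PrintCFram.LevelCriterion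

end
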